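import Summits.KontsevichZagierPeriods.KontsevichZagierPeriods.Theorems.SoloInformedToricVertexMove
import HarnessLib

/-!
# Domain splitting and rule (2) along monomial charts, on presentable classes

Solo programme `solo-KontsevichZagierPeriods-informed`, session s105 (toolkit for the first
cube-DEGENERATE denominators: THEOREM DIAG in `SoloInformedToricTriangleCharts`, THEOREM CUSP
in `SoloInformedToricCuspCharts`).

Two reusable moves of the KZ calculus on presentable classes (`soloInformedPresentable`:
`ℤ`-combinations of cube integrals of real parts of germs, modulo `KZ.relations`):

* `soloInformed_presentable_of_cover` — **domain splitting**: if `σ = D₁ ∪ D₂` up to a null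
  set, `D₁ ∩ D₂` is null, and both restrictions `[Dᵢ, f]` are presentable, then so is
  `[σ, f]` (rule (1a); null pieces are relations);
* `soloInformed_presentable_of_monoChart` — **rule (2) along a monomial chart** `μ_A`
  (`det A ≠ 0`): if `R` lives on `μ_A((0,1)ⁿ)` and the pulled-back form
  `f(μ_A v) |det Dμ_A(v)| = P'(v)/Q'(v)` falls under a presentability criterion on the open
  cube, then `of R` is presentable;

and two small facts used with them: monomials are cube-nondegenerate
(`soloInformed_cubeNondegenerate_X`), and cube-nondegeneracy of a vertex reflection of `Q`
forces `Q ≠ 0` on the open cube (`soloInformed_aeval_ne_zero_of_vertexReflect_nondegenerate`).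

References: M. Kontsevich, D. Zagier, *Periods* (2001) §1.2 rules (1), (2); W. Fulton,
*Introduction to Toric Varieties* (1993) §2.6.
-/

noncomputable section

open scoped BigOperators
open MeasureTheory Set
open Literature.NumberTheory.Transcendental Literature.NumberTheory.Transcendental.KZ
open Literature.ModelTheory.ExponentialFields (IsSemialgebraic)

namespace Summit.KontsevichZagierPeriods.KontsevichZagierPeriods.Theorems

variable {n : ℕ}

/-! ## Domain splitting -/

/-- **Domain splitting.**  If `D₁, D₂ ⊆ σ` are `ℚ`-semialgebraic with `D₁ ∩ D₂` and
`σ ∖ (D₁ ∪ D₂)` null, and both restrictions are presentable, then `[σ, f]` is presentable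
(rule (1a); null pieces are relations). [this work] -/
theorem soloInformed_presentable_of_cover (r : IntegralRep n) {D₁ D₂ : Set (Fin n → ℝ)}
    (h₁ : IsSemialgebraic ℚ D₁) (h₂ : IsSemialgebraic ℚ D₂) (hD₁ : D₁ ⊆ r.domain)
    (hD₂ : D₂ ⊆ r.domain) (hnull : volume (D₁ ∩ D₂) = 0)
    (hvol : volume (r.domain \ (D₁ ∪ D₂)) = 0)
    (hp₁ : of (r.restrict D₁ h₁ hD₁) ∈ soloInformedPresentable)
    (hp₂ : of (r.restrict D₂ h₂ hD₂) ∈ soloInformedPresentable) :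
    of r ∈ soloInformedPresentable := by
  have hE : IsSemialgebraic ℚ (D₁ ∪ D₂) := h₁.union h₂
  have hEr : D₁ ∪ D₂ ⊆ r.domain := union_subset hD₁ hD₂
  have h0 : of r - of (r.restrict (D₁ ∪ D₂) hE hEr) ∈ relations :=
    r.of_sub_of_restrict_mem_relations hE hEr hvol
  have hadd : of (r.restrict (D₁ ∪ D₂) hE hEr) - of (r.restrict D₁ h₁ hD₁) -
      of (r.restrict D₂ h₂ hD₂) ∈ relations :=
    domainAddRel_subset_relations ⟨n, r.restrict (D₁ ∪ D₂) hE hEr, r.restrict D₁ h₁ hD₁,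
      r.restrict D₂ h₂ hD₂, rfl, hnull, fun _ _ => rfl, fun _ _ => rfl, rfl⟩
  have h : of r - (of (r.restrict D₁ h₁ hD₁) + of (r.restrict D₂ h₂ hD₂)) ∈ relations := by
    have h' := relations.add_mem h0 hadd
    convert h' using 1
    abel
  exact soloInformed_presentable_of_sub_mem h (soloInformed_presentable_add hp₁ hp₂)

/-! ## Rule (2) along a monomial chart -/

/-- **Rule (2) along a monomial chart.**  Let `det A ≠ 0`, `Q'` non-vanishing on `(0,1)ⁿ`,
`R` an `IntegralRep` on `μ_A((0,1)ⁿ)` whose pulled-back form is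
`R.integrand (μ_A v) · |det Dμ_A(v)| = P'(v)/Q'(v)` on `(0,1)ⁿ`, and suppose every
`IntegralRep` on `(0,1)ⁿ` with integrand `P'/Q'` is presentable.  Then `of R` is
presentable. [this work] -/
theorem soloInformed_presentable_of_monoChart (A : Matrix (Fin n) (Fin n) ℕ)
    (hA : (A.map (fun t : ℕ => (t : ℝ))).det ≠ 0) (P' Q' : MvPolynomial (Fin n) ℚ)
    (hQ' : ∀ v ∈ soloInformedOpenCube n, MvPolynomial.aeval v Q' ≠ 0) (R : IntegralRep n)
    (hdom : R.domain =
      (fun (v : Fin n → ℝ) (i : Fin n) => ∏ j, v j ^ A i j) '' soloInformedOpenCube n)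
    (hRi : ∀ v ∈ soloInformedOpenCube n,
      R.integrand (fun i => ∏ j, v j ^ A i j) * |(soloInformedMonoD A v).det| =
        MvPolynomial.aeval v P' / MvPolynomial.aeval v Q')
    (hpres : ∀ ρ : IntegralRep n, ρ.domain = soloInformedOpenCube n →
      EqOn ρ.integrand (fun v => MvPolynomial.aeval v P' / MvPolynomial.aeval v Q')
        (soloInformedOpenCube n) → of ρ ∈ soloInformedPresentable) :
    of R ∈ soloInformedPresentable := by
  have hO := soloInformedOpenCube_eq_pi n
  have hmeasO : MeasurableSet (soloInformedOpenCube n) := by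
    rw [hO]; exact MeasurableSet.univ_pi fun _ => measurableSet_Ioo
  have hderiv : ∀ x ∈ soloInformedOpenCube n, HasFDerivWithinAt
      (fun (v : Fin n → ℝ) (i : Fin n) => ∏ j, v j ^ A i j) (soloInformedMonoD A x)
      (soloInformedOpenCube n) x :=
    fun x _ => soloInformed_hasFDerivWithinAt_monomialMap A _ x
  have hinj : InjOn (fun (v : Fin n → ℝ) (i : Fin n) => ∏ j, v j ^ A i j)
      (soloInformedOpenCube n) := by
    rw [hO]; exact injOn_monomialMap_pi_Ioo hA
  have hint1 : IntegrableOn (fun v => |(soloInformedMonoD A v).det| •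
      R.integrand (fun i => ∏ j, v j ^ A i j)) (soloInformedOpenCube n) := by
    have h := R.integrableOn
    rw [hdom, integrableOn_image_iff_integrableOn_abs_det_fderiv_smul volume hmeasO hderiv hinj]
      at h
    exact h
  have hint' : IntegrableOn (fun v => MvPolynomial.aeval v P' / MvPolynomial.aeval v Q')
      (soloInformedOpenCube n) :=
    hint1.congr_fun (fun v hv => by
      show |(soloInformedMonoD A v).det| • R.integrand _ = _
      rw [smul_eq_mul, mul_comm]; exact hRi v hv) hmeasO
  set ρt := IntegralRep.ofRational (soloInformedOpenCube n) P' Q'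
    (isSemialgebraic_soloInformedOpenCube n) hQ' hint' with hρt
  have h2 : of ρt - of R ∈ relations := by
    refine changeOfVariablesRel_subset_relations ⟨n, ρt, R,
      fun (v : Fin n → ℝ) (i : Fin n) => ∏ j, v j ^ A i j, soloInformedMonoD A,
      isSemialgebraicMapOn_monomialMap A (isSemialgebraic_soloInformedOpenCube n), hderiv, hinj,
      ?_, fun v hv => ?_, rfl⟩
    · show R.domain = _ '' soloInformedOpenCube n
      exact hdom
    · have hv' : v ∈ soloInformedOpenCube n := hv
      show MvPolynomial.aeval v P' / MvPolynomial.aeval v Q' = _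
      exact (hRi v hv').symm
  have hp := hpres ρt rfl fun v _ => rfl
  rw [← neg_sub] at h2
  exact soloInformed_presentable_of_sub_mem (by simpa using relations.neg_mem h2) hp

/-- Monomials `xⱼ` are cube-nondegenerate. [this work] -/
theorem soloInformed_cubeNondegenerate_X (j : Fin n) :
    SoloInformedCubeNondegenerate (MvPolynomial.X j : MvPolynomial (Fin n) ℚ) := by
  classical
  refine soloInformed_cubeNondegenerate_of_pos _ (MvPolynomial.X_ne_zero j) fun a ha => ?_
  rw [MvPolynomial.support_X, Finset.mem_singleton] at ha
  subst ha
  rw [← pow_one (MvPolynomial.X j), MvPolynomial.X_pow_eq_monomial, MvPolynomial.coeff_monomial,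
    if_pos rfl]
  exact one_pos

/-- Pull-back of an arbitrary polynomial along a monomial chart: `P(μ_A v) = P_A(v)` with
`P_A = chartQuot A P 0`. [this work] -/
theorem soloInformed_aeval_monomialMap_chartQuot_zero (A : Matrix (Fin n) (Fin n) ℕ)
    (P : MvPolynomial (Fin n) ℚ) (v : Fin n → ℝ) :
    MvPolynomial.aeval (fun i => ∏ j, v j ^ A i j) P =
      MvPolynomial.aeval v (soloInformedChartQuot A P 0) := by
  rw [soloInformed_aeval_monomialMap_eq A P 0 (fun _ _ _ => Nat.zero_le _) v]
  simp

/-- Non-vanishing on the open cube from cube-nondegeneracy of a vertex reflection. [this work] -/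
theorem soloInformed_aeval_ne_zero_of_vertexReflect_nondegenerate (S : Finset (Fin n))
    {Q : MvPolynomial (Fin n) ℚ}
    (hND : SoloInformedCubeNondegenerate (soloInformedVertexReflect S Q)) {v : Fin n → ℝ}
    (hv : v ∈ soloInformedOpenCube n) : MvPolynomial.aeval v Q ≠ 0 := by
  have h := soloInformed_aeval_ne_zero_of_nondegenerate hND (x := soloInformedVertexMove S v)
    fun i => ⟨(soloInformed_vertexMove_mem S hv i).1, (soloInformed_vertexMove_mem S hv i).2.le⟩
  rwa [soloInformed_aeval_vertexReflect, soloInformed_vertexMove_vertexMove] at h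

end Summit.KontsevichZagierPeriods.KontsevichZagierPeriods.Theorems
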